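import Summits.CriticalPhenomena.CardyFormulaZ2.Theorems.CardySelfDualSegmentUniformMarginalityRussoBoundLargeMesh
import Summits.CriticalPhenomena.CardyFormulaZ2.Theorems.CardySelfDualSegmentUniformMarginalityStubPextContinuous

/-!
# Vocabulary of the line `pivotal-balance-heat-flow` for the crux `UniformMarginality`, part 3:
the RESHAPED skeleton (tame Russo bound + transport)
(stmt-CriticalPhenomena-5472, route `CardySelfDualSegment`)

Third definitions file of the lead's line `Sketch`. The first skeleton closed the crux from the
exact Russo identity (R) [landed], continuity (C) [landed] and ONE research stub, `RussoBound`: a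
bound on `∂_t P_t(R,δ)` locally in `t`, uniformly in the mesh, for EVERY conformal rectangle `R`.
This file RESHAPES that stub into two, keeping the composition idea (Russo identity + δ-uniform
derivative bound + mean value theorem), because `RussoBound` over ALL Jordan domains is very
probably FALSE while the crux may well be true:

* WHY (recorded in full in `Cruxes/UniformMarginality/Lines/Sketch.md`; heuristic, building on the
  disprover's comb `Cruxes/UniformMarginality/Disproof.lean` §3): hang a sequence of FLAT COMB GADGETS
  `G_k` (the disprover's single-scale comb: `2^{h_k+1}` anti-diagonal corridors of `h_k` corners each,
  mesh `δ_k = ρ_k 2^{-h_k-3}`, physical size `ρ_k → 0`) on arc 1 of a rectangle, stacked vertically and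
  accumulating at mark 2 (so the boundary stays a Jordan curve: excursion diameters `→ 0`, threads short
  and never above/below another gadget). At mesh `δ_k` the crude crossing probability splits EXACTLY as
  `P_t(R*) = P_t(A_k) + E_t[𝟙_{B_k} g_k]`, `g_k = 1 − ∏_{i ∈ S∩S'} (1 − ½ (½ − t/4)^{h_k})` the
  probability that one of the corridors joined by the bulk is open; `∂_t g_k ≈ −0.18 h_k` for
  `t ≲ 1/h_k` while its total variation in `t` is `≤ 1`. Hence `|∂_t P_t(R*, δ_k)| ≳ 0.18 h_k π_k − O(1)`
  with `π_k = P_t(B_k) > 0` essentially independent of `h_k`: choosing `h_k ≫ 1/π_k` makes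
  `sup_δ |∂_t P_t(R*, δ)|` infinite near `t₀ = 0`, i.e. `¬ RussoBound`, whereas the SIGNAL
  `|P_t − P_{t₀}|(δ_k) ≤ π_k → 0` is compatible with the crux (uniform integrability of `∂_t P` in `t`
  survives, Lipschitz does not). The constant of any Russo bound sees the lattice-scale geometry of
  `∂R` (disprover, §3: the R-uniform strengthening is false), and along one wild boundary it can be
  made to blow up scale by scale.
* THE RESHAPE. (B₁) `RussoBoundRectilinear`: the δ-uniform local bound on `∂_t P_t(R,δ)` for
  conformal rectangles whose boundary is covered by finitely many axis-parallel segments (the tame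
  class of the tree's proved `CardyBoundaryCoulombGas.RectilinearSuffices`; no multi-scale boundary
  hardware is possible there) — the research content proper (antidiagonal-odd / five-arm census at
  rate 3/4, bulk and flat-boundary/corner terms only). (B₂) `RectilinearTransport`: the δ-uniform
  modulus of continuity passes from rectilinear conformal rectangles to all of them — inner/outer
  rectilinear quads in mixed position sandwich the crude event monotonically (pattern of
  `RectilinearSufficesSandwich`), and the difference of the two tame crossing probabilities is small
  UNIFORMLY in `t` and `δ` by half-plane three-arm counting along flat stretches and at the `π/2`,
  `3π/2` corners, which needs `t`-uniform RSW for `M_t` (route crux `UniformBoxCrossing`,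
  stmt-CriticalPhenomena-5476) and an arm-separation toolbox for `M_t`; difficulty L given those.
* PROVED here: the per-rectangle mean value glue `integratedBoundAt_of` and the composition
  `uniformMarginality_of_stubs2 : RussoBoundRectilinear → RectilinearTransport → UniformMarginality`
  (with the landed `stub_russoIdentity`, `stub_pextContinuous`).

Nothing here is asserted: `IsRectilinear`, `RussoBoundAt`, `IntegratedBoundAt`,
`RussoBoundRectilinear`, `RectilinearTransport` are statements POSITED BY THE LINE, not literature
facts, never relocated.
-/

noncomputable section

namespace Summit.CriticalPhenomena.CardyFormulaZ2.Cruxes.UniformMarginality.HeatFlow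

open MeasureTheory Literature.Probability.Percolation Literature.Probability.LatticeModels
  Literature.Probability.RandomPlanarGeometry
open scoped Classical

/-- TAME conformal rectangles: the boundary is covered by finitely many axis-parallel segments
(verbatim the hypothesis of the tree's `CardyBoundaryCoulombGas.RectilinearSuffices`). -/
def IsRectilinear (R : ConformalRectangle) : Prop :=
  ∃ S : Finset (ℂ × ℂ), (∀ p ∈ S, p.1.re = p.2.re ∨ p.1.im = p.2.im) ∧
    frontier R.carrier ⊆ ⋃ p ∈ S, segment ℝ p.1 p.2

/-- `RussoBound` AT ONE conformal rectangle: the Russo sum `∂_t P_t(R,δ)` is locally bounded in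
`t`, uniformly in the mesh. (`RussoBound ↔ ∀ R, RussoBoundAt R`, definitional.) -/
def RussoBoundAt (R : ConformalRectangle) : Prop :=
  ∀ t₀ : ℝ, t₀ ∈ Set.Icc (0 : ℝ) 1 → ∃ η > 0, ∃ C : ℝ,
    ∀ δ : ℝ, 0 < δ → ∀ t ∈ Set.Ioo (0 : ℝ) 1, |t - t₀| < η → |deriv (Pext R δ) t| ≤ C

/-- `IntegratedBound` AT ONE conformal rectangle: a modulus of continuity of `t ↦ P_t(R,δ)`
uniform in the mesh. (`IntegratedBound ↔ ∀ R, IntegratedBoundAt R`, definitional; the crux is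
`IntegratedBound` by `uniformMarginality_of_integratedBound` / the disprover's `crux_iff_integratedBound`.) -/
def IntegratedBoundAt (R : ConformalRectangle) : Prop :=
  ∀ t₀ : ℝ, t₀ ∈ Set.Icc (0 : ℝ) 1 → ∀ ε > 0, ∃ η > 0,
    ∀ δ : ℝ, 0 < δ → ∀ t ∈ Set.Icc (0 : ℝ) 1, |t - t₀| < η → |Pext R δ t - Pext R δ t₀| < ε

/-- STUB (B₁) — **the Russo bound on rectilinear conformal rectangles** (the research content of the
crux in Lipschitz form, asked only where it is plausible: tame boundaries admit no multi-scale
hardware; by `russoBound_largeMesh` only the regime `δ → 0⁺` is at stake). -/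
def RussoBoundRectilinear : Prop :=
  ∀ R : ConformalRectangle, IsRectilinear R → RussoBoundAt R

/-- STUB (B₂) — **rectilinear transport of the δ-uniform modulus of continuity**: if every
rectilinear conformal rectangle has a mesh-uniform modulus of continuity in `t`, so does every
conformal rectangle (inner/outer rectilinear sandwiches in mixed position + `t`-uniform tightness of
the pair, by `t`-uniform RSW / half-plane three-arm counting for `M_t`). -/
def RectilinearTransport : Prop :=
  (∀ R : ConformalRectangle, IsRectilinear R → IntegratedBoundAt R) → IntegratedBound

/-- Bookkeeping: the global statements are the conjunctions of the local ones. -/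
theorem russoBound_iff_forall : RussoBound ↔ ∀ R : ConformalRectangle, RussoBoundAt R :=
  Iff.rfl

/-- Bookkeeping: the global statements are the conjunctions of the local ones. -/
theorem integratedBound_iff_forall :
    IntegratedBound ↔ ∀ R : ConformalRectangle, IntegratedBoundAt R :=
  Iff.rfl

end Summit.CriticalPhenomena.CardyFormulaZ2.Cruxes.UniformMarginality.HeatFlow

end

namespace Summit.CriticalPhenomena.CardyFormulaZ2.Cruxes.UniformMarginality.HeatFlow

open MeasureTheory Literature.Probability.Percolation Literature.Probability.LatticeModels
  Literature.Probability.RandomPlanarGeometry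

/-- **Mean value glue at one rectangle** (the proof of the landed `integratedBound_of`, which is
pointwise in `R`): differentiability on `(0,1)` (from the landed `stub_russoIdentity`), continuity
(landed `stub_pextContinuous`) and `RussoBoundAt R` give `IntegratedBoundAt R`. -/
theorem integratedBoundAt_of (R : ConformalRectangle) (hB : RussoBoundAt R) :
    IntegratedBoundAt R := by
  intro t₀ ht₀ ε hε
  obtain ⟨η₁, hη₁, C, hCb⟩ := hB t₀ ht₀
  set C' : ℝ := max C 1 with hC'
  have hC'pos : 0 < C' := lt_of_lt_of_le one_pos (le_max_right C 1)
  have hCC' : C ≤ C' := le_max_left C 1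
  refine ⟨min η₁ (ε / (2 * C')), lt_min hη₁ (by positivity), ?_⟩
  intro δ hδ t ht htt₀
  have hη₁' : |t - t₀| < η₁ := lt_of_lt_of_le htt₀ (min_le_left _ _)
  have hηε : |t - t₀| < ε / (2 * C') := lt_of_lt_of_le htt₀ (min_le_right _ _)
  obtain ⟨K, -, hderiv⟩ := stub_russoIdentity R δ hδ
  have hcont : Continuous (Pext R δ) := stub_pextContinuous R δ hδ
  have hdiff : ∀ c ∈ Set.Ioo (0 : ℝ) 1, DifferentiableAt ℝ (Pext R δ) c :=
    fun c hc => (hderiv c hc).differentiableAt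
  have key : ∀ a b : ℝ, a ∈ Set.Icc (0 : ℝ) 1 → b ∈ Set.Icc (0 : ℝ) 1 → a < b →
      |a - t₀| < η₁ → |b - t₀| < η₁ → |Pext R δ b - Pext R δ a| ≤ C' * (b - a) := by
    intro a b ha hb hab haη hbη
    have hco : ContinuousOn (Pext R δ) (Set.Icc a b) := hcont.continuousOn
    have hdo : DifferentiableOn ℝ (Pext R δ) (Set.Ioo a b) := by
      intro c hc
      exact (hdiff c ⟨lt_of_le_of_lt ha.1 hc.1, lt_of_lt_of_le hc.2 hb.2⟩).differentiableWithinAt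
    obtain ⟨c, hc, hcslope⟩ := exists_deriv_eq_slope (Pext R δ) hab hco hdo
    have hc01 : c ∈ Set.Ioo (0 : ℝ) 1 := ⟨lt_of_le_of_lt ha.1 hc.1, lt_of_lt_of_le hc.2 hb.2⟩
    have hcη : |c - t₀| < η₁ := by
      rw [abs_lt] at haη hbη ⊢
      constructor <;> linarith [hc.1, hc.2]
    have hbound : |deriv (Pext R δ) c| ≤ C' := (hCb δ hδ c hc01 hcη).trans hCC'
    have hba : 0 < b - a := sub_pos.2 hab
    have heq : Pext R δ b - Pext R δ a = deriv (Pext R δ) c * (b - a) := by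
      rw [hcslope, div_mul_cancel₀ _ hba.ne']
    rw [heq, abs_mul, abs_of_pos hba]
    exact mul_le_mul_of_nonneg_right hbound hba.le
  have ht₀η : |t₀ - t₀| < η₁ := by simpa using hη₁
  rcases lt_trichotomy t t₀ with hlt | heq | hgt
  · have h := key t t₀ ht ht₀ hlt hη₁' ht₀η
    have hpos : 0 < t₀ - t := sub_pos.2 hlt
    have habs : |t - t₀| = t₀ - t := by rw [abs_sub_comm]; exact abs_of_pos hpos
    calc |Pext R δ t - Pext R δ t₀| = |Pext R δ t₀ - Pext R δ t| := abs_sub_comm _ _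
      _ ≤ C' * (t₀ - t) := h
      _ < C' * (ε / (2 * C')) := by rw [← habs]; exact mul_lt_mul_of_pos_left hηε hC'pos
      _ = ε / 2 := by field_simp
      _ < ε := by linarith
  · subst heq; simpa using hε
  · have h := key t₀ t ht₀ ht hgt ht₀η hη₁'
    have hpos : 0 < t - t₀ := sub_pos.2 hgt
    have habs : |t - t₀| = t - t₀ := abs_of_pos hpos
    calc |Pext R δ t - Pext R δ t₀| ≤ C' * (t - t₀) := h
      _ < C' * (ε / (2 * C')) := by rw [← habs]; exact mul_lt_mul_of_pos_left hηε hC'pos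
      _ = ε / 2 := by field_simp
      _ < ε := by linarith

/-- **Composition of the reshaped line**: the tame Russo bound (B₁) and the rectilinear transport
(B₂) imply the crux decl `CardySelfDualSegment.UniformMarginality` by name (with the landed
(R) = `stub_russoIdentity`, (C) = `stub_pextContinuous` inside `integratedBoundAt_of`, and the
landed `uniformMarginality_of_integratedBound`). -/
theorem uniformMarginality_of_stubs2 :
    RussoBoundRectilinear → RectilinearTransport →
      Summit.CriticalPhenomena.CardyFormulaZ2.Theses.CardySelfDualSegment.UniformMarginality :=
  fun hT hX => uniformMarginality_of_integratedBound
    (hX fun R hR => integratedBoundAt_of R (hT R hR))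

/-- The old stub implies the new pair's first half (so nothing proved toward `RussoBound` is lost),
and together with a trivial transport it still closes the crux through the landed glue. -/
theorem russoBoundRectilinear_of_russoBound (h : RussoBound) : RussoBoundRectilinear :=
  fun R _ => h R

end Summit.CriticalPhenomena.CardyFormulaZ2.Cruxes.UniformMarginality.HeatFlow
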